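/-
Copyright (c) 2026 the pub-hodgecm-mathlib formalisation cell (harness21).  Prover seat hodgecm-mathlib-K2Liu-p05 (g4), 2026-09-04
(Track B «K2-LIT», crux hLiu418 = stmt-HodgeConjecture-24832, LEAD F0P6-plan (g13) RULING M-157d organ (K∞-str), file F2 = THE FACE:
`K`-finite continuous functions on a compact subgroup of `U(n)` are polynomials in the matrix entries and their conjugates).
-/
import Summits.HodgeConjecture.HodgeConjecture.Theorems.K2LiuCompactGroupFiniteFunctions     -- (K∞-str) F1: the generic engine
import Literature.RepresentationTheory.CompactGroups.CompactMatrixGroupAlgebraic            -- ★ `totalDegree_bind₁_le_of_forall_le_one`, `U(n)` compact (instance)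
import Mathlib.Algebra.MvPolynomial.Monad
import HarnessLib

/-!
# (K∞-str, F2) THE FACE: right-`K`-finite continuous functions on a compact `K ≤ U(n)` are polynomial in the entries and their conjugates

Track B ∕ K2-LIT, hLiu418 = stmt-HodgeConjecture-24832; LEAD F0P6-plan (g13) RULING M-157d (1) «for a closed subgroup `K ≤ Matrix.unitaryGroup (Fin m) ℂ` and
`f : K → ℂ` continuous with `FiniteDimensional ℂ (span ℂ (range fun k₀ => fun k => f (k * k₀)))`, `∃ P : MvPolynomial ((Fin m × Fin m) ⊕ (Fin m × Fin m)) ℂ,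
∀ k, f k = MvPolynomial.eval (Sum.elim (fun ij => (k:Matrix) ij.1 ij.2) (fun ij => conj ((k:Matrix) ij.1 ij.2))) P`» (consumers (k1) A∞ faces, (k2) #42S step S2,
(k3) (β5)).  Namespace `Summit.HodgeConjecture.HodgeConjecture.Cruxes.HLiu418.K2LiuCompactGroupFiniteFunctions` (continued).  THEOREMS ONLY (no definition, no
instance, no notation, no named fact, no `sorry`); `--supports stmt-HodgeConjecture-24832 --as helper`.

PROOF.  The engine (F1) ★ `exists_mem_of_finiteDimensional_span_rightTranslates` applied to the compact group `K` and the DEGREE FILTRATION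
`A d := (restrictTotalDegree d).map (MvPolynomial.aeval gen)`, `gen = (entries, conjugate entries) : (n × n) ⊕ (n × n) → C(K, ℂ)` — all objects local to the proof,
no definition is introduced.  The eight hypotheses of the engine: monotone and finite-dimensional (Mathlib `restrictTotalDegree`); LEFT∕RIGHT translation stable
(the entries of `y k` ∕ `k k₀` are linear in the entries of `k`: substitution `bind₁` by polynomials of degree `≤ 1`, ★ `totalDegree_bind₁_le_of_forall_le_one` — the
complex twin of ★ `PolynomialFunctionsUnitaryGroup.comp_mulRight_mem_map_restrictTotalDegree`); `star`-stable (`star (aeval gen P) = aeval gen (rename swap (map conj P))`);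
`1` and products (`aeval` is an algebra homomorphism, `totalDegree_mul`); point separation (the entries separate `K`).  The right-finiteness hypothesis of the face
(stated on bare functions `K → ℂ`) transports to `C(K, ℂ)` along the injective `ContinuousMap.coeFnLinearMap`.  Stated for an arbitrary finite index type `n`
(`n = Fin m` is M-157d's letter).

HONEST LABEL: HC_CM is proved only modulo the 7 printed citations (2 remaining named inputs: hLiu418 = stmt-HodgeConjecture-24832, h413 =
stmt-HodgeConjecture-24833) until rung 0 closes; organ capital, moves no counter.

## References
[BrockerTomDieck1985] T. Bröcker, T. tom Dieck, *Representations of Compact Lie Groups*, GTM 98 (1985), III (1.5), III Thm. (3.1), III (4.1) and VI (the algebra of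
representative functions of a closed subgroup of `U(n)`) · [Chevalley1946] C. Chevalley, *Theory of Lie Groups I* (1946), Ch. VI §§VIII–IX · [OnishchikVinberg1990]
A. L. Onishchik, E. B. Vinberg, *Lie Groups and Algebraic Groups* (1990), Ch. 5 §2 Thm. 5.
-/

set_option autoImplicit false
set_option linter.dupNamespace false

noncomputable section

open scoped ComplexConjugate
open MeasureTheory

namespace Summit.HodgeConjecture.HodgeConjecture.Cruxes.HLiu418.K2LiuCompactGroupFiniteFunctions

/-! ## §1 Two degree bounds -/

section Degree

variable {σ τ R S : Type*} [CommSemiring R] [CommSemiring S]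

/-- mapping the coefficients does not raise the total degree. [folklore] -/
theorem totalDegree_map_le (f : R →+* S) (p : MvPolynomial σ R) : (MvPolynomial.map f p).totalDegree ≤ p.totalDegree := by
  classical
  exact Finset.sup_mono (MvPolynomial.support_map_subset f p)

/-- a linear form `Σ_l X_{v l} · C (c l)` has total degree `≤ 1`. [folklore] -/
theorem totalDegree_sum_X_mul_C_le {ι : Type*} [Fintype ι] [Nontrivial R] (v : ι → τ) (c : ι → R) :
    (∑ l, MvPolynomial.X (v l) * MvPolynomial.C (c l) : MvPolynomial τ R).totalDegree ≤ 1 := by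
  refine MvPolynomial.totalDegree_finsetSum_le fun l _ => (MvPolynomial.totalDegree_mul _ _).trans ?_
  rw [MvPolynomial.totalDegree_C, add_zero]
  exact (MvPolynomial.totalDegree_X (R := R) (v l)).le

/-- a linear form `Σ_l C (c l) · X_{v l}` has total degree `≤ 1`. [folklore] -/
theorem totalDegree_sum_C_mul_X_le {ι : Type*} [Fintype ι] [Nontrivial R] (v : ι → τ) (c : ι → R) :
    (∑ l, MvPolynomial.C (c l) * MvPolynomial.X (v l) : MvPolynomial τ R).totalDegree ≤ 1 := by
  refine MvPolynomial.totalDegree_finsetSum_le fun l _ => (MvPolynomial.totalDegree_mul _ _).trans ?_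
  rw [MvPolynomial.totalDegree_C, zero_add]
  exact (MvPolynomial.totalDegree_X (R := R) (v l)).le

/-- `eval g (bind₁ h φ) = eval (fun i => eval g (h i)) φ` (★ `MvPolynomial.eval₂Hom_bind₁` at the identity). [folklore] -/
theorem eval_bind₁ (g : τ → R) (h : σ → MvPolynomial τ R) (φ : MvPolynomial σ R) :
    MvPolynomial.eval g (MvPolynomial.bind₁ h φ) = MvPolynomial.eval (fun i => MvPolynomial.eval g (h i)) φ :=
  MvPolynomial.eval₂Hom_bind₁ _ _ _ _

end Degree

/-! ## §2 The face -/

section Unitary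

variable {n : Type} [Fintype n] [DecidableEq n]

/-- **`K`-FINITE CONTINUOUS FUNCTIONS ON A COMPACT SUBGROUP OF `U(n)` ARE POLYNOMIAL IN THE ENTRIES AND THEIR CONJUGATES** (LEAD M-157d (1), the face of organ
(K∞-str)).  For a closed subgroup `K ≤ U(n)` and a continuous `f : K → ℂ` whose right translates `k ↦ f (k k₀)` span a finite-dimensional space, there is a complex
polynomial `P` in the `2n²` letters `x_{ij}`, `x̄_{ij}` with `f(k) = P(k_{ij}, conj k_{ij})` for every `k ∈ K` — the engine (F1) ★ `exists_mem_of_finiteDimensional_span_rightTranslates`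
at the degree filtration of the polynomial functions, whose translation∕`star`∕product stability is degree bookkeeping and whose density is point separation by the
entries. [cite: BrockerTomDieck1985, III (1.5) and Thm. (3.1)] [cite: Chevalley1946, Ch. VI §VIII] [cite: OnishchikVinberg1990, Ch. 5 §2 Thm. 5] -/
theorem exists_mvPolynomial_of_finiteDimensional_span_rightTranslates
    (K : Subgroup (Matrix.unitaryGroup n ℂ)) (hK : IsClosed (K : Set (Matrix.unitaryGroup n ℂ)))
    (f : K → ℂ) (hf : Continuous f)
    (hfin : FiniteDimensional ℂ (Submodule.span ℂ (Set.range fun k₀ : K => fun k : K => f (k * k₀)))) :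
    ∃ P : MvPolynomial ((n × n) ⊕ (n × n)) ℂ, ∀ k : K,
      f k = MvPolynomial.eval
        (Sum.elim (fun ij : n × n => ((k : Matrix.unitaryGroup n ℂ) : Matrix n n ℂ) ij.1 ij.2)
          (fun ij : n × n => conj (((k : Matrix.unitaryGroup n ℂ) : Matrix n n ℂ) ij.1 ij.2))) P := by
  classical
  haveI : CompactSpace K := isCompact_iff_compactSpace.mp hK.isCompact
  letI : MeasurableSpace K := borel K
  haveI : BorelSpace K := ⟨rfl⟩
  -- the entry functions and the evaluation `Φ = aeval gen : ℂ[x, x̄] →ₐ C(K, ℂ)`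
  let mat : K → Matrix n n ℂ := fun k => ((k : Matrix.unitaryGroup n ℂ) : Matrix n n ℂ)
  have hmat : Continuous mat := continuous_subtype_val.comp continuous_subtype_val
  have hmat_mul : ∀ k k' : K, mat (k * k') = mat k * mat k' := fun k k' => rfl
  let vals : K → ((n × n) ⊕ (n × n)) → ℂ := fun k =>
    Sum.elim (fun ij : n × n => mat k ij.1 ij.2) (fun ij : n × n => conj (mat k ij.1 ij.2))
  let gen : ((n × n) ⊕ (n × n)) → C(K, ℂ) := fun c =>
    match c with
    | Sum.inl ij => ⟨fun k => mat k ij.1 ij.2, hmat.matrix_elem ij.1 ij.2⟩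
    | Sum.inr ij => ⟨fun k => conj (mat k ij.1 ij.2), Complex.continuous_conj.comp (hmat.matrix_elem ij.1 ij.2)⟩
  have hgen : ∀ c k, gen c k = vals k c := fun c k => by
    rcases c with ij | ij <;> rfl
  let Φ : MvPolynomial ((n × n) ⊕ (n × n)) ℂ →ₐ[ℂ] C(K, ℂ) := MvPolynomial.aeval gen
  -- `(Φ P) k = P(vals k)`
  have hΦ : ∀ (P : MvPolynomial ((n × n) ⊕ (n × n)) ℂ) (k : K), Φ P k = MvPolynomial.eval (vals k) P := by
    intro P k
    have h1 : (ContinuousMap.evalAlgHom ℂ ℂ k).comp Φ = MvPolynomial.aeval (vals k) := by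
      rw [MvPolynomial.comp_aeval]
      congr 1
      funext c
      exact hgen c k
    have h2 : Φ P k = MvPolynomial.aeval (vals k) P := by
      have h3 := congrArg (fun ψ : MvPolynomial ((n × n) ⊕ (n × n)) ℂ →ₐ[ℂ] ℂ => ψ P) h1
      simpa only [AlgHom.comp_apply, ContinuousMap.evalAlgHom_apply] using h3
    rw [h2]
    exact congrFun (MvPolynomial.aeval_eq_eval (vals k)) P
  -- the degree filtration
  let A : ℕ → Submodule ℂ C(K, ℂ) := fun d => (MvPolynomial.restrictTotalDegree ((n × n) ⊕ (n × n)) ℂ d).map Φ.toLinearMap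
  have hAmem : ∀ d (a : C(K, ℂ)), a ∈ A d ↔ ∃ P : MvPolynomial ((n × n) ⊕ (n × n)) ℂ, P.totalDegree ≤ d ∧ Φ P = a := fun d a => by
    simp only [A, Submodule.mem_map, MvPolynomial.mem_restrictTotalDegree, AlgHom.toLinearMap_apply]
  -- (1) monotone, (2) finite-dimensional
  have hmono : Monotone A := fun d d' hdd' a ha => by
    obtain ⟨P, hP, rfl⟩ := (hAmem d a).1 ha
    exact (hAmem d' _).2 ⟨P, hP.trans hdd', rfl⟩
  have hAfin : ∀ d, FiniteDimensional ℂ (A d) := fun d => inferInstance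
  -- substitution by degree-≤ 1 forms keeps the degree; the generators of `k k₀` and `y k`
  have hsubst : ∀ d (L : ((n × n) ⊕ (n × n)) → MvPolynomial ((n × n) ⊕ (n × n)) ℂ) (hL : ∀ c, (L c).totalDegree ≤ 1)
      (P : MvPolynomial ((n × n) ⊕ (n × n)) ℂ), P.totalDegree ≤ d → (MvPolynomial.bind₁ L P).totalDegree ≤ d :=
    fun d L hL P hP => (Literature.RepresentationTheory.CompactGroups.totalDegree_bind₁_le_of_forall_le_one L hL P).trans hP
  have hbind : ∀ (L : ((n × n) ⊕ (n × n)) → MvPolynomial ((n × n) ⊕ (n × n)) ℂ) (g : K → K) (hg : Continuous g),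
      (∀ c k, MvPolynomial.eval (vals k) (L c) = vals (g k) c) →
      ∀ P : MvPolynomial ((n × n) ⊕ (n × n)) ℂ, Φ (MvPolynomial.bind₁ L P) = (Φ P).comp ⟨g, hg⟩ := by
    intro L g hg hLg P
    ext k
    rw [ContinuousMap.comp_apply, hΦ, hΦ, eval_bind₁]
    -- `eval (fun c => eval (vals k) (L c)) P = eval (vals (g k)) P`
    exact congrArg (fun F : ((n × n) ⊕ (n × n)) → ℂ => MvPolynomial.eval F P) (funext fun c => hLg c k)
  -- (3) right translation
  have hright : ∀ d (k₀ : K) (a : C(K, ℂ)), a ∈ A d → a.comp (ContinuousMap.mulRight k₀) ∈ A d := by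
    intro d k₀ a ha
    obtain ⟨P, hP, rfl⟩ := (hAmem d a).1 ha
    let L : ((n × n) ⊕ (n × n)) → MvPolynomial ((n × n) ⊕ (n × n)) ℂ := fun c =>
      match c with
      | Sum.inl ij => ∑ l : n, MvPolynomial.X (Sum.inl (ij.1, l)) * MvPolynomial.C (mat k₀ l ij.2)
      | Sum.inr ij => ∑ l : n, MvPolynomial.X (Sum.inr (ij.1, l)) * MvPolynomial.C (conj (mat k₀ l ij.2))
    have hL : ∀ c, (L c).totalDegree ≤ 1 := fun c => by
      rcases c with ij | ij
      · exact totalDegree_sum_X_mul_C_le _ _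
      · exact totalDegree_sum_X_mul_C_le _ _
    have hLg : ∀ c k, MvPolynomial.eval (vals k) (L c) = vals (k * k₀) c := fun c k => by
      rcases c with ⟨i, j⟩ | ⟨i, j⟩
      · simp only [L, vals, map_sum, map_mul, MvPolynomial.eval_X, MvPolynomial.eval_C, Sum.elim_inl, hmat_mul, Matrix.mul_apply]
      · simp only [L, vals, map_sum, map_mul, MvPolynomial.eval_X, MvPolynomial.eval_C, Sum.elim_inr, hmat_mul, Matrix.mul_apply]
    refine (hAmem d _).2 ⟨MvPolynomial.bind₁ L P, hsubst d L hL P hP, ?_⟩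
    rw [hbind L (fun k => k * k₀) (continuous_mul_const k₀) hLg P]
    rfl
  -- (4) left translation
  have hleft : ∀ d (y : K) (a : C(K, ℂ)), a ∈ A d → a.comp (ContinuousMap.mulLeft y) ∈ A d := by
    intro d y a ha
    obtain ⟨P, hP, rfl⟩ := (hAmem d a).1 ha
    let L : ((n × n) ⊕ (n × n)) → MvPolynomial ((n × n) ⊕ (n × n)) ℂ := fun c =>
      match c with
      | Sum.inl ij => ∑ l : n, MvPolynomial.C (mat y ij.1 l) * MvPolynomial.X (Sum.inl (l, ij.2))
      | Sum.inr ij => ∑ l : n, MvPolynomial.C (conj (mat y ij.1 l)) * MvPolynomial.X (Sum.inr (l, ij.2))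
    have hL : ∀ c, (L c).totalDegree ≤ 1 := fun c => by
      rcases c with ij | ij
      · exact totalDegree_sum_C_mul_X_le _ _
      · exact totalDegree_sum_C_mul_X_le _ _
    have hLg : ∀ c k, MvPolynomial.eval (vals k) (L c) = vals (y * k) c := fun c k => by
      rcases c with ⟨i, j⟩ | ⟨i, j⟩
      · simp only [L, vals, map_sum, map_mul, MvPolynomial.eval_X, MvPolynomial.eval_C, Sum.elim_inl, hmat_mul, Matrix.mul_apply]
      · simp only [L, vals, map_sum, map_mul, MvPolynomial.eval_X, MvPolynomial.eval_C, Sum.elim_inr, hmat_mul, Matrix.mul_apply]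
    refine (hAmem d _).2 ⟨MvPolynomial.bind₁ L P, hsubst d L hL P hP, ?_⟩
    rw [hbind L (fun k => y * k) (continuous_const_mul y) hLg P]
    rfl
  -- (5) star
  have hstar : ∀ d (a : C(K, ℂ)), a ∈ A d → star a ∈ A d := by
    intro d a ha
    obtain ⟨P, hP, rfl⟩ := (hAmem d a).1 ha
    refine (hAmem d _).2 ⟨MvPolynomial.rename Sum.swap (MvPolynomial.map (starRingEnd ℂ) P),
      (MvPolynomial.totalDegree_rename_le _ _).trans ((totalDegree_map_le _ P).trans hP), ?_⟩
    ext k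
    rw [hΦ, MvPolynomial.eval_rename, MvPolynomial.eval_map, ContinuousMap.star_apply, hΦ, Complex.star_def,
      ← MvPolynomial.eval₂_id, MvPolynomial.hom_eval₂, (starRingEnd ℂ).comp_id]
    congr 1
    funext c
    rcases c with ⟨i, j⟩ | ⟨i, j⟩
    · rfl
    · exact (Complex.conj_conj _).symm
  -- (6) one, (7) products
  have hone : ∃ d, (1 : C(K, ℂ)) ∈ A d := ⟨0, (hAmem 0 1).2 ⟨1, MvPolynomial.totalDegree_one.le, map_one Φ⟩⟩
  have hmul : ∀ d d' (a b : C(K, ℂ)), a ∈ A d → b ∈ A d' → ∃ d'', a * b ∈ A d'' := by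
    intro d d' a b ha hb
    obtain ⟨P, hP, rfl⟩ := (hAmem d a).1 ha
    obtain ⟨Q, hQ, rfl⟩ := (hAmem d' b).1 hb
    exact ⟨d + d', (hAmem _ _).2 ⟨P * Q, (MvPolynomial.totalDegree_mul P Q).trans (add_le_add hP hQ), map_mul Φ P Q⟩⟩
  -- (8) the entries separate the points of `K`
  have hsep : ∀ x y : K, x ≠ y → ∃ d, ∃ a ∈ A d, a x ≠ a y := by
    intro x y hxy
    have hne : mat x ≠ mat y := fun h => hxy (Subtype.ext (Subtype.ext h))
    obtain ⟨i, j, hij⟩ : ∃ i j, mat x i j ≠ mat y i j := by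
      by_contra! h
      exact hne (Matrix.ext fun i j => h i j)
    refine ⟨1, Φ (MvPolynomial.X (Sum.inl (i, j))), (hAmem 1 _).2 ⟨_, (MvPolynomial.totalDegree_X (R := ℂ) _).le, rfl⟩, ?_⟩
    rw [hΦ, hΦ, MvPolynomial.eval_X, MvPolynomial.eval_X]
    exact hij
  -- the right-finiteness hypothesis, transported to `C(K, ℂ)`
  set F : C(K, ℂ) := ⟨f, hf⟩ with hFdef
  have hW : FiniteDimensional ℂ (Submodule.span ℂ (Set.range fun k₀ : K => F.comp (ContinuousMap.mulRight k₀))) := by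
    have hinj : Function.Injective (ContinuousMap.coeFnLinearMap ℂ : C(K, ℂ) →ₗ[ℂ] K → ℂ) := fun a b h => ContinuousMap.ext (congrFun h)
    have hmap : (Submodule.span ℂ (Set.range fun k₀ : K => F.comp (ContinuousMap.mulRight k₀))).map (ContinuousMap.coeFnLinearMap ℂ) =
        Submodule.span ℂ (Set.range fun k₀ : K => fun k : K => f (k * k₀)) := by
      rw [Submodule.map_span, ← Set.range_comp]
      rfl
    haveI : FiniteDimensional ℂ ((Submodule.span ℂ (Set.range fun k₀ : K => F.comp (ContinuousMap.mulRight k₀))).map (ContinuousMap.coeFnLinearMap ℂ)) := by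
      rw [hmap]
      exact hfin
    exact LinearEquiv.finiteDimensional (Submodule.equivMapOfInjective _ hinj _).symm
  -- the engine
  obtain ⟨d, hd⟩ := exists_mem_of_finiteDimensional_span_rightTranslates A hmono hAfin hleft hright hstar hone hmul hsep F hW
  obtain ⟨P, -, hP⟩ := (hAmem d F).1 hd
  refine ⟨P, fun k => ?_⟩
  rw [← hΦ, hP]
  rfl

end Unitary

end Summit.HodgeConjecture.HodgeConjecture.Cruxes.HLiu418.K2LiuCompactGroupFiniteFunctions

end
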